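import Summits.KontsevichZagierPeriods.KontsevichZagierPeriods.Theses.HeckeMultiplicityOne

/-!
# KontsevichZagierPeriods / HeckeMultiplicityOne — the `Assembly` (stmt-KontsevichZagierPeriods-4694)

Route `KontsevichZagierPeriods/HeckeMultiplicityOne` (multiplicity one certifies Manin ratios; Conjecture 1
in commensurability form), assembly item stmt-KontsevichZagierPeriods-4694 (`Assembly`):

  `Commensurability → TorsionFree → KontsevichZagierPeriods` (both antecedents inlined verbatim).

Informal content.  Let `r`, `r'` be KZ-rational integral representations with the same value `v`.
`Commensurability` gives nonzero integers `a`, `b` with `a·[r] − b·[r'] ∈ KZ.relations`; by SOUNDNESS of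
the calculus (`KZ.relations_le_ker_eval_holds`, proved in the tree) `(a − b)·v = 0`.
* If `v ≠ 0` then `a = b`, so `a·([r] − [r']) ∈ KZ.relations` and `TorsionFree` divides by `a`.
* If `v = 0`, compare each of `r`, `r'` with the ZERO representation `z = ∫_σ 0/1` on its own domain:
  `z` is KZ-rational of value `0` and `[z] ∈ KZ.relations` by integrand additivity (`0 = 0 + 0` gives
  `[z] − [z] − [z] ∈ relations`).  `Commensurability` against `z` gives `a'·[r] − b'·[z] ∈ relations`,
  hence `a'·[r] ∈ relations`, and `TorsionFree` gives `[r] ∈ relations`; likewise `[r'] ∈ relations`,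
  so `[r] − [r'] ∈ relations`.

The two antecedents are the route's target `Commensurability` (crux, item 4687) and the support
`TorsionFree` (item 4691, proved in `HeckeMultiplicityOneTorsionFree.lean`); the theorem here is the
implication, nothing more.

References: M. Kontsevich, D. Zagier, *Periods* (2001), §1.2 (Conjecture 1, the three rules);
A. Huber, S. Müller-Stach, *Periods and Nori Motives* (2017), Ch. 13.
-/

namespace Summit.KontsevichZagierPeriods.HeckeMultiplicityOne

open MeasureTheory MvPolynomial
open Literature.NumberTheory.Transcendental

/-- **The zero representation lies in the relations.**  On the (`ℚ`-semialgebraic) domain `σ` of any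
integral representation `r` there is a KZ-rational representation `z = ∫_σ 0/1` of value `0` whose
class `[z]` lies in `KZ.relations`: integrand additivity `0 = 0 + 0` on `σ` gives
`[z] − [z] − [z] = −[z] ∈ KZ.relations`. [Kontsevich–Zagier 2001, §1.2, rule (1)] [folklore] -/
theorem exists_isRational_value_zero_mem_relations {n : ℕ} (r : KZ.IntegralRep n) :
    ∃ z : KZ.IntegralRep n, z.IsRational ∧ z.value = 0 ∧ KZ.of z ∈ KZ.relations := by
  have hq : ∀ x ∈ r.domain, aeval x (1 : MvPolynomial (Fin n) ℚ) ≠ 0 := by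
    intro x _
    simp
  have hint : IntegrableOn (fun x : Fin n → ℝ =>
      aeval x (0 : MvPolynomial (Fin n) ℚ) / aeval x (1 : MvPolynomial (Fin n) ℚ)) r.domain := by
    simp only [map_zero, zero_div]
    exact integrableOn_zero
  refine ⟨KZ.IntegralRep.ofRational r.domain 0 1 r.isSemialgebraic_domain hq hint,
    KZ.IntegralRep.isRational_ofRational _ _ _ _ _ _, ?_, ?_⟩
  · simp
  · set z := KZ.IntegralRep.ofRational r.domain 0 1 r.isSemialgebraic_domain hq hint with hz
    have hmem : KZ.of z - KZ.of z - KZ.of z ∈ KZ.relations := by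
      apply KZ.integrandAddRel_subset_relations
      refine ⟨n, z, z, z, rfl, rfl, ?_, rfl⟩
      intro x _
      simp [hz]
    have hneg : -KZ.of z ∈ KZ.relations := by
      have e : KZ.of z - KZ.of z - KZ.of z = -KZ.of z := by abel
      rwa [e] at hmem
    exact neg_mem_iff.mp hneg

/-- **Route item `HeckeMultiplicityOne.Assembly`** (settles stmt-KontsevichZagierPeriods-4694):
`Commensurability → TorsionFree → KontsevichZagierPeriods`.  Given KZ-rational `r`, `r'` of equal value
`v`, commensurability gives `a, b ≠ 0` with `a·[r] − b·[r'] ∈ KZ.relations`; soundness of the moves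
(`KZ.relations_le_ker_eval_holds`) gives `(a − b)·v = 0`.  If `v ≠ 0` then `a = b` and torsion-freeness
divides by `a`.  If `v = 0`, commensurability of each of `r`, `r'` with the zero representation
(`exists_isRational_value_zero_mem_relations`, class in `KZ.relations`) and torsion-freeness give
`[r], [r'] ∈ KZ.relations`, hence `[r] − [r'] ∈ KZ.relations`. Pure logic over the route's own
declarations plus the proved soundness fact. [Kontsevich–Zagier 2001, §1.2] [folklore] -/
theorem assembly_proof :
    Summit.KontsevichZagierPeriods.KontsevichZagierPeriods.Theses.HeckeMultiplicityOne.Assembly := by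
  unfold Summit.KontsevichZagierPeriods.KontsevichZagierPeriods.Theses.HeckeMultiplicityOne.Assembly
  intro hC hT n m r r' hr hr' hv
  show KZ.of r - KZ.of r' ∈ KZ.relations
  by_cases hv0 : r.value = 0
  · -- value zero: both classes lie in the relations
    have key : ∀ {k : ℕ} (s : KZ.IntegralRep k), s.IsRational → s.value = 0 →
        KZ.of s ∈ KZ.relations := by
      intro k s hs hs0
      obtain ⟨z, hz, hz0, hzrel⟩ := exists_isRational_value_zero_mem_relations s
      obtain ⟨a, b, ha, -, hab⟩ := hC s z hs hz (hs0.trans hz0.symm)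
      have hsmul : a • KZ.of s ∈ KZ.relations := by
        have hb' : b • KZ.of z ∈ KZ.relations := KZ.relations.zsmul_mem hzrel b
        simpa using KZ.relations.add_mem hab hb'
      exact hT _ a ha hsmul
    exact KZ.relations.sub_mem (key r hr hv0) (key r' hr' (hv.symm.trans hv0))
  · -- value nonzero: soundness forces `a = b`
    obtain ⟨a, b, ha, -, hab⟩ := hC r r' hr hr' hv
    have hker := KZ.relations_le_ker_eval_holds hab
    rw [AddMonoidHom.mem_ker, map_sub, map_zsmul, map_zsmul, KZ.eval_of, KZ.eval_of, ← hv,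
      zsmul_eq_mul, zsmul_eq_mul, ← sub_mul, mul_eq_zero] at hker
    have hab' : a = b := by
      rcases hker with h | h
      · exact_mod_cast sub_eq_zero.mp h
      · exact absurd h hv0
    rw [← hab'] at hab
    refine hT _ a ha ?_
    rwa [smul_sub]

end Summit.KontsevichZagierPeriods.HeckeMultiplicityOne
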